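import Summits.HodgeConjecture.HodgeConjecture.Theorems.R90S5MemAPacketOfMultOfLaws          -- ★ (this seat) `mem_aPacket_of_m_ne_zero_of_laws`: §13.10 ¶3 membership half over the ★ dictionary `TwistedComparisonSpectralSide`
import Summits.HodgeConjecture.HodgeConjecture.Theorems.F0P3cDbTEnvelopeTrichotomy         -- ★ brings `MemXiFamily`, `CMCharIdentityPackageTestSigned`, `xiLocalChar`, the constituent currency (as in S5 file D)
import Summits.HodgeConjecture.HodgeConjecture.Theorems.F0P3cStCharTSNe                    -- ★ Ne-glue `ne_comap_πn_of_isSupercuspidal` (a supercuspidal class is not `πⁿ ∘ e`)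
import Literature.NumberTheory.Rogawski1990.CharIdentityOnTestFunctionsSigned              -- ★ `CMLocalAPacket.CharIdentityAtTest` with signed member traces
import Summits.HodgeConjecture.HodgeConjecture.Theorems.F0P3cStCharTSCharField             -- ★ `qsForm_map_cmConjRingHom_transpose` : `(σΦ₃)ᵀ = Φ₃`
import Summits.HodgeConjecture.HodgeConjecture.Theorems.F0P3cStCharTSShellOrbitalGCan      -- ★ `F0P3cStCharTSShellOrbitalG.isUnit_det_qsForm` : `IsUnit (det Φ₃)`
import HarnessLib

/-!
# R90-TF · S5 «Ch. 13.3 multiplicity ∕ rigidity» — S5#4 ROAD α, THE §13.10 COMPOSITION WITH NAMED PINS (pointwise): from a lawful twisted-comparison datum `𝔨`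
# (★ dictionary `TwistedComparisonSpectralSide`) READING the record objects of one instance `(L, P, ξ, v)`, every supercuspidal `v`-constituent of `P` completes
# `πⁿ(ξ_v) ∘ e` in the SIGNED [13.1.4] — i.e. clause (β) of the LH10 leaf at `H := Φ₃`, for THIS instance

Cell `hodgecm-mathlib`, crux H413 (`stmt-HodgeConjecture-24833`), route of record `HCCMUnconditional`; programme R90-TF (brief `director/R90-BRIEF.v2.md`
1f40d54518340a35), section S5 = Ch. 13.3 (base `R90-C133`), seat R90-C133-p01 (g0), socket S5#4 `R90.S5.stub_R90_1335_qsXiRigidity` ROAD α «§13.10 GLOBAL SIGN ARGUMENT»;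
R90-C133-plan (g0) DEAL #3 2026-09-04T15:39:27Z («the PIN-SHAPED composition … the `hPin_*` binders ARE the junction bytes S10 (zero-slice `TwistedComparisonData` datum,
R90-C138) ∕ E-S4 must export»).  Lane `--supports stmt-HodgeConjecture-24833 --as helper`; ONE theorem, no definition, no instance, no notation, no `sorry`; Lines-free.
HONEST LABEL: HC_CM is proved only modulo the 7 printed citations (2 remaining named inputs: hLiu418 = stmt-HodgeConjecture-24832, h413 = stmt-HodgeConjecture-24833)
until rung 0 closes; this file proves NO printed global statement outright — it proves print's §13.10 ¶3 deduction «discrete `P` with the `ξ`-string ⇒ `P ∈ Π(ξ)` ⇒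
`P_v ∈ {πⁿ, πˢ}(ξ_v)`» FROM the printed relations (`𝔨.Laws`, class P on a posited datum) and NAMED PINS reading the record; the pins are the explicit debt (CENSUS §3 rows J-S5→S10).

## The pins (ONE NAMED BINDER EACH; each is USED; none quantifies over a kit — L8: hypotheses on ONE `𝔨`)
* `cls : 𝔨.𝔊.Rep`, `hPin_m : 𝔨.𝔊.m cls ≠ 0` — «`P` read in the dictionary; `P` occurs discretely» [§13.3 p. 201 «`m(π)` … in the discrete spectrum»; §14.5 p. 238].
* `ξH : 𝔨.𝔊.PacketH`, `hPin_1dim : 𝔨.IsOneDimH ξH`, `hPin_notTheta : ¬ 𝔨.𝔊.IsTheta ξH` — «`ξ` read in `Π(H)`; one-dimensional; not `ρ(θ)`» [§13.3 p. 202; Lemma 13.6.3 (c)].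
* `hPin_germ : MemXiFamily P … ξ → 𝔨.germRep cls = 𝔨.germI ξH` — «a `Π(ξ)`-envelope member has the e.v.p. string `ψ_G(t(P)) = t(I_{ξ̃′})`» = ROAD γ (R90-C133-p03, ★ p861410
  `xiString_*` at record level) read through the pin [Thm 13.3.5's engine: SMO for GL₂∕GL₃ + Lemma 13.6.3, p. 231].
* `πsRec`, `hPin_memA : ∀ Π, IsAPacket Π → ξH ↦ Π → cls ∈ Π → every v-constituent of P is πⁿ(ξ_v) ∘ e or πsRec` — «membership in the global A-packet READ AT the non-split
  place `v`: `π_v ∈ Π(ξ_v) = {πⁿ(ξ_v), πˢ(ξ_v)}`» [§13.3 p. 201 «the set of `π = ⊗π_v` such that `π_v ∈ Π_v` for all `v`»; §13.1 p. 199 l. 6] — E-S4∕S1 local packet of record.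
* `hS3 : ⟨πⁿ ∘ e, some πsRec⟩` satisfies the SIGNED [13.1.4] on test functions at `(ξ_v, Δ_v, m, ν)` — S3's letter [Prop. 13.1.4; §4.9]; at the D-record choice
  `πsRec := ((hQS ξ).1 v …).πs` it is ★ `CMNonsplitCharIdentityAtTestSigned.charIdentityAtTestSigned_πs`, and any other signed partner equals that one (★ `eq_πs_of_charIdentityAtTestSigned`, p861449).

## The proof (print, §13.10 p. 230 ¶3)
★ `mem_aPacket_of_m_ne_zero_of_laws` (⟸ ★ `aPacketMult_of_laws` = Thm 13.3.7 for `Π(ξ)` ⟸ (13.8.3) `eq1383_of_laws` + `APacketLift` + `LinIndepGerm` = Prop. 13.8.1): in the germ of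
`t(I_{ξ̃′})`, `m(cls) ≠ 0 ⇒ cls ∈ Π(ξ)`; `hPin_memA` puts the `v`-constituent `c` in `{πⁿ ∘ e, πsRec}`; `c` supercuspidal is not `πⁿ ∘ e` (★ `ne_comap_πn_of_isSupercuspidal`, the Keys
label `πⁿ` is not `L²`-type … via `hK`); so `c = πsRec` and `hS3` is the identity.  The closed form over all instances is the sibling `R90S5QsRigidCoreScOfPinnedXiData`
(one ∀∃-binder = the junction socket J-S5→S10), and (β)@Φ₃ ⟹ (QS-U) is ★ `qsScUnique_of_rigidCoreScQs` (p861426).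

[cite: Rogawski1990, §13.10 pp. 230–231; Thm 13.3.5, Thm 13.3.6 (c) p. 202, Thm 13.3.7 p. 203; §13.3 p. 201; §13.1 p. 199, Prop. 13.1.3 (d), Prop. 13.1.4; §13.8 Prop. 13.8.1 p. 213, (13.8.3) p. 218; Lemma 13.6.3 p. 211; §4.9 p. 55]
[cite: Marshall2014, §3.4] [cite: LanglandsShelstad1987, §1]
-/

set_option autoImplicit false
-- the mandated namespace repeats the single-problem summit's segment (`HodgeConjecture.HodgeConjecture`)
set_option linter.dupNamespace false

noncomputable section

open NumberField IsDedekindDomain MeasureTheory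
open scoped Matrix ComplexOrder

open Literature.NumberTheory Literature.NumberTheory.Automorphic Literature.NumberTheory.Automorphic.UnitaryGroup
open Literature.NumberTheory.Automorphic.IdeleClassGroup
open Literature.NumberTheory.GaloisRepresentations
open Literature.NumberTheory.Rogawski1990
open Summit.HodgeConjecture.HodgeConjecture.Cruxes.H413

namespace Summit.HodgeConjecture.HodgeConjecture.R90.S5

set_option synthInstance.maxHeartbeats 400000 in
set_option maxHeartbeats 8000000 in
open scoped Classical in
/-- **S5#4 ROAD α — §13.10 ¶3 WITH NAMED PINS, at one instance `(L, P, ξ, v)` of the quasi-split `U(Φ₃)`**: for a lawful twisted-comparison datum `𝔨` (★ dictionary; `𝔨.Laws` =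
the printed relations Thm 10.3.1 (a), Props 13.5.1∕13.6.1∕13.6.2, §13.7 separation, 13.7 (2)(3)(4) coefficient laws, Thm 13.2.1∕Prop 13.2.2 lifts, Prop 13.8.1, §14.6 readings) and
pins `cls ∕ hPin_m ∕ ξH ∕ hPin_1dim ∕ hPin_notTheta ∕ hPin_germ ∕ πsRec ∕ hPin_memA ∕ hS3` reading the record objects (module docstring), EVERY SUPERCUSPIDAL `v`-constituent `c` of the
discrete `P` with `MemXiFamily P … ξ` makes `⟨πⁿ(ξ_v) ∘ e, some c⟩` satisfy the SIGNED [13.1.4] on test functions at `(ξ.xiLocalChar v, ν_H, Δ_v, m_H, m_G)` with the frame sign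
`ε_v = (if ∃ z unit, a = z·σz then 1 else −1)` — clause (β) of the LH10 leaf `StubXiPacketRigidCoreSc` at `H := qsForm L`, for this instance.  Print: `m(P) ≠ 0` and
`ψ_G(t(P)) = t(I_{ξ̃′})` ⇒ `P ∈ Π(ξ)` (Thm 13.3.7 ∕ ★ `mem_aPacket_of_m_ne_zero_of_laws`) ⇒ `P_v ∈ {πⁿ, πˢ}(ξ_v) ∘ e`; `c` supercuspidal ⇒ `c = πˢ` (★ Ne-glue) ⇒ [13.1.4] (`hS3`).
[cite: Rogawski1990, §13.10 pp. 230–231; Thm 13.3.7 p. 203; §13.3 p. 201; §13.1 Prop. 13.1.3 (d), Prop. 13.1.4 p. 199] -/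
theorem rigidCoreScQsAt_of_laws_of_pins (L : Type) [Field L] [NumberField L] [IsCMField L]
    (v : HeightOneSpectrum (𝓞 ↥(maximalRealSubfield L))) (hns : ∀ w : PlacesOver L v, IsCMField.complexConj L • w.1 = w.1)
    [MeasurableSpace ((cmDatum L 3 (qsForm L)).Local v)]
    [MeasurableSpace ((cmDatum L 2 (Matrix.of fun i j : Fin 2 => if i.val + j.val + 1 = 2 then (1 : L) else 0)).Local v ×
      (cmDatum L 1 (Matrix.of fun i j : Fin 1 => if i.val + j.val + 1 = 1 then (1 : L) else 0)).Local v)]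
    [∀ a : ((cmDatum L 2 (Matrix.of fun i j : Fin 2 => if i.val + j.val + 1 = 2 then (1 : L) else 0)).Local v ×
        (cmDatum L 1 (Matrix.of fun i j : Fin 1 => if i.val + j.val + 1 = 1 then (1 : L) else 0)).Local v),
      MeasurableSpace (((cmDatum L 2 (Matrix.of fun i j : Fin 2 => if i.val + j.val + 1 = 2 then (1 : L) else 0)).Local v ×
        (cmDatum L 1 (Matrix.of fun i j : Fin 1 => if i.val + j.val + 1 = 1 then (1 : L) else 0)).Local v) ⧸
        Subgroup.centralizer ({a} : Set ((cmDatum L 2 (Matrix.of fun i j : Fin 2 => if i.val + j.val + 1 = 2 then (1 : L) else 0)).Local v ×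
        (cmDatum L 1 (Matrix.of fun i j : Fin 1 => if i.val + j.val + 1 = 1 then (1 : L) else 0)).Local v)))]
    [∀ γ : (cmDatum L 3 (qsForm L)).Local v,
      MeasurableSpace ((cmDatum L 3 (qsForm L)).Local v ⧸ Subgroup.centralizer ({γ} : Set ((cmDatum L 3 (qsForm L)).Local v)))]
    (Δv : LocalTransferFactor L (qsForm L) v)
    (mHv : OrbitalMeasureFamily ((cmDatum L 2 (Matrix.of fun i j : Fin 2 => if i.val + j.val + 1 = 2 then (1 : L) else 0)).Local v ×
        (cmDatum L 1 (Matrix.of fun i j : Fin 1 => if i.val + j.val + 1 = 1 then (1 : L) else 0)).Local v))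
    (mGv : OrbitalMeasureFamily ((cmDatum L 3 (qsForm L)).Local v))
    (νGv : Measure ((cmDatum L 3 (qsForm L)).Local v))
    (νHv : Measure ((cmDatum L 2 (Matrix.of fun i j : Fin 2 => if i.val + j.val + 1 = 2 then (1 : L) else 0)).Local v ×
        (cmDatum L 1 (Matrix.of fun i j : Fin 1 => if i.val + j.val + 1 = 1 then (1 : L) else 0)).Local v))
    (μω : HeckeCharacter L) (hμu : μω.IsUnitary) (ξ : OneDimAutRepH L)
    (μA : Measure (adelicGroupData (↥(maximalRealSubfield L)) L (IsCMField.complexConj L) 3 (qsForm L)).automorphicQuotient)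
    [(adelicGroupData (↥(maximalRealSubfield L)) L (IsCMField.complexConj L) 3 (qsForm L)).IsAutomorphicMeasure μA]
    (P : DiscreteAutomorphicRep (adelicGroupData (↥(maximalRealSubfield L)) L (IsCMField.complexConj L) 3 (qsForm L)) μA)
    (hmem : MemXiFamily P (F0P3cStCharTSCharField.qsForm_map_cmConjRingHom_transpose L) (F0P3cStCharTSShellOrbitalG.isUnit_det_qsForm L) μω hμu ξ)
    (T : GL (Fin 3) (LocalRing L v)) (a : LocalRing L v) (ha : IsUnit a)
    (h : formCongr (conjLocal L (IsCMField.complexConj L) v) T ((qsForm L).map (algebraMap L (LocalRing L v))) =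
      a • (Matrix.of fun i j : Fin 3 => if i.val + j.val + 1 = 3 then (1 : L) else 0).map (algebraMap L (LocalRing L v)))
    (π2 πn : IrrClass (Gqs L v))
    (hK : KeysCaseTwoLabels L v (μω.semilocalComponent L v) (torusLocalComponent L (IsCMField.complexConj L) v ξ.η)
      (torusLocalComponent L (IsCMField.complexConj L) v ξ.ψ) π2 πn)
    -- the ★ dictionary datum and its printed relations
    {TGt TG TH : Type} (𝔨 : TwistedComparisonData TGt TG TH) (hlaws : 𝔨.Laws)
    -- PINS (dictionary → record), one named binder each
    (cls : 𝔨.𝔊.Rep) (hPin_m : 𝔨.𝔊.m cls ≠ 0)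
    (ξH : 𝔨.𝔊.PacketH) (hPin_1dim : 𝔨.IsOneDimH ξH) (hPin_notTheta : ¬ 𝔨.𝔊.IsTheta ξH)
    (hPin_germ : MemXiFamily P (F0P3cStCharTSCharField.qsForm_map_cmConjRingHom_transpose L) (F0P3cStCharTSShellOrbitalG.isUnit_det_qsForm L) μω hμu ξ →
      𝔨.germRep cls = 𝔨.germI ξH)
    (πsRec : IrrClass ((cmDatum L 3 (qsForm L)).Local v))
    (hPin_memA : ∀ Pk : 𝔨.𝔊.Packet, 𝔨.𝔊.IsAPacket Pk → 𝔨.𝔊.liftsTo ξH Pk → 𝔨.𝔊.mem cls Pk →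
      ∀ c : IrrClass ((cmDatum L 3 (qsForm L)).Local v),
        (IrrClass.comap (localPiEquiv L (IsCMField.complexConj L) 3 (qsForm L) v) c).IsConstituentOf
            (P.finRep.smoothPart.toRepresentation.comp (inclPlace (↥(maximalRealSubfield L)) L (IsCMField.complexConj L) 3 (qsForm L) v)) →
        c = IrrClass.comap (cmDatumLocalCongr L v T ha h).symm πn ∨ c = πsRec)
    (hS3 : (⟨IrrClass.comap (cmDatumLocalCongr L v T ha h).symm πn, some πsRec⟩ : CMLocalAPacket L (qsForm L) v).CharIdentityAtTest L (qsForm L) v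
      (fun c' f => (if ∃ z : LocalRing L v, IsUnit z ∧ a = z * conjLocal L (IsCMField.complexConj L) v z then (1 : ℂ) else -1) *
      c'.smoothTrace νGv f)
      (ξ.xiLocalChar v) νHv Δv mHv mGv) :
    -- clause (β) at this instance
    ∀ c : IrrClass ((cmDatum L 3 (qsForm L)).Local v),
      (IrrClass.comap (localPiEquiv L (IsCMField.complexConj L) 3 (qsForm L) v) c).IsConstituentOf
          (P.finRep.smoothPart.toRepresentation.comp (inclPlace (↥(maximalRealSubfield L)) L (IsCMField.complexConj L) 3 (qsForm L) v)) →
      c.IsSupercuspidal →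
      (⟨IrrClass.comap (cmDatumLocalCongr L v T ha h).symm πn, some c⟩ : CMLocalAPacket L (qsForm L) v).CharIdentityAtTest L (qsForm L) v
      (fun c' f => (if ∃ z : LocalRing L v, IsUnit z ∧ a = z * conjLocal L (IsCMField.complexConj L) v z then (1 : ℂ) else -1) *
      c'.smoothTrace νGv f)
      (ξ.xiLocalChar v) νHv Δv mHv mGv := by
  intro c hc hsc
  obtain ⟨Pk, hA, hL, hmemPk⟩ := mem_aPacket_of_m_ne_zero_of_laws 𝔨 hlaws ξH hPin_1dim hPin_notTheta
  rcases hPin_memA Pk hA hL (hmemPk cls (hPin_germ hmem) hPin_m) c hc with hπn | hπs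
  · exact absurd hπn (F0P3cStCharTSNe.ne_comap_πn_of_isSupercuspidal L (qsForm L) v hns T a ha h (μω.semilocalComponent L v)
      (torusLocalComponent L (IsCMField.complexConj L) v ξ.η) (torusLocalComponent L (IsCMField.complexConj L) v ξ.ψ) π2 πn hK c hsc)
  · rw [hπs]
    exact hS3

end Summit.HodgeConjecture.HodgeConjecture.R90.S5

end
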